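import Summits.AnomalousDissipation.AnomalousDissipation.Theses.StirringSphere
import Literature.Analysis.FluidPDE.StatisticalSolutionProofs
import Literature.Analysis.FluidPDE.StatisticalSolutionEnergyEq
import Literature.Analysis.FluidPDE.SteadyNavierStokesEnergy
import Literature.Analysis.FluidPDE.SteadyNavierStokesProofs

/-!
# STRATEGY CENSUS — typed companion (crux `StirringSphere.BoundedSphereStatistics`, stmt-AnomalousDissipation-17145)

Crux-strategist seat `planner-cstrat-stmt-AnomalousDissipation-17145-b1-0` (route `route-AnomalousDissipation-StirringSphere`).
Prose lives in `STRATEGY-CENSUS.md`; this file only TYPES the census' attempts and PROVES the cheap implications between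
them, so that every "no leverage" claim of the census points at a kernel-checked statement. Nothing here closes the item.
`sorry`-free. The live skeleton `Lines/birth.lean` (stubs `stub_calmRestFlows`, `stub_calmStatistics`,
`stub_boundedSteadySphere`) is read, NOT touched and NOT imported.

* §0 `basis`, `force c = f_c = Σ cᵢ bᵢ`, `BoundedAt E ν₀ c`, `crux_iff` (the crux by name ⟺ its `E, ν₀, c`-form);
  `force_admissible` (every `f_c` smooth / solenoidal / mean-zero — the tactic block of the route's `closes`, verbatim);
  `norm_force_le` (`‖f_c(x)‖ ≤ 9` on the closed unit ball of `c`).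
* §1 WHAT IS IN TREE AT FIXED ν (the meta-fact behind every thin seam): `perViscosity` — for every `ν > 0` and EVERY `c` with
  `‖c‖ ≤ 1` the Dirac mass at Temam's steady state is a stationary statistical solution of NS_ν(f_c) with integrable mean
  energy `≤ 81/(16π⁴ν²)`; hence `crux_withoutUniformity` — the crux with `∃ E` moved inside `∀ ν` is a THEOREM. The whole
  content of the crux is the ν-UNIFORMITY of one number, uniformly on the sphere.
* §S STRENGTHEN. `RelativeFloorSphere c₀` (S⁺_rel: statistics paying `c₀·energy ≤ dissipation`); PROVED
  `crux_of_relativeFloorSphere` (S⁺_rel → crux with `E = 81/c₀²`, from the in-tree ensemble power budget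
  `ensembleDissipation_le_of_isStationary_holds`). `SteadySphere` / `CalmRestSphere` are the registered stubs' contents
  (restated by value, for the record of §S of the census).
* §D DECOMPOSITION. `LocallyBounded` (local-in-`c` uniform bounds) and the PROVED uniformisation over the compact sphere
  `crux_of_locallyBounded` (finite subcover); `Pointwise` ∧ `Robust` → `LocallyBounded` (`locallyBounded_of_pointwise_robust`,
  PROVED). The seam is soft topology; the kernel sits in `Pointwise` (= the energy half of the zeroth law, force by force) and
  the ν-UNIFORM force-robustness `Robust` (Cheskidov's species).
* §N NEGATION. `not_crux_iff` (PROVED): a disproof must defeat EVERY level `E` at SOME direction and SOME small ν by a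
  UNIVERSAL lower bound over all stationary statistical solutions there; `not_crux_of_hoardingDirection` (PROVED): one
  direction hoarding at all small ν suffices — and `HoardingDirection` is what no engine delivers in 3-D (census §N).
-/

noncomputable section

-- `Summit.<Summit>.<Problem>` repeats the summit segment by the D-0017 layout.
set_option linter.dupNamespace false

open MeasureTheory Filter Topology Set UnitAddTorus
open scoped BigOperators ENNReal

namespace Summit.AnomalousDissipation.AnomalousDissipation.Cruxes.BoundedSphereStatistics.StrategyCensus

open Literature.Analysis Literature.Analysis.FunctionSpaces Literature.Analysis.FluidPDE
open Summit.AnomalousDissipation.AnomalousDissipation.Theses.StirringSphere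

/-! ## §0 The crux in `E, ν₀, c`-form -/

/-- The explicit basis `(b₀, b₁, b₂)` of the stirring sphere — VERBATIM the literal of the route decl
`StirringSphere.BoundedSphereStatistics` (`b₀ = f_GP`, `b₁ = curl b₀ / 2π`, `b₂` on the shell `|k|² = 2`). -/
def basis : Fin 3 → UnitAddTorus (Fin 3) → EuclideanSpace ℝ (Fin 3) :=
  ![(fun x : UnitAddTorus (Fin 3) => (Literature.Analysis.FluidPDE.Torus.stokesMode (Pi.single (2 : Fin 3) (1 : ℤ)) (EuclideanSpace.single (0 : Fin 3) (1 : ℝ)) false x + Literature.Analysis.FluidPDE.Torus.stokesMode (Pi.single (0 : Fin 3) (1 : ℤ)) (EuclideanSpace.single (1 : Fin 3) (1 : ℝ)) false x + Literature.Analysis.FluidPDE.Torus.stokesMode (Pi.single (1 : Fin 3) (1 : ℤ)) (EuclideanSpace.single (2 : Fin 3) (1 : ℝ)) false x : EuclideanSpace ℝ (Fin 3))), (fun x : UnitAddTorus (Fin 3) => (Literature.Analysis.FluidPDE.Torus.stokesMode (Pi.single (1 : Fin 3) (1 : ℤ)) (EuclideanSpace.single (0 : Fin 3) (1 : ℝ))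 true x + Literature.Analysis.FluidPDE.Torus.stokesMode (Pi.single (2 : Fin 3) (1 : ℤ)) (EuclideanSpace.single (1 : Fin 3) (1 : ℝ)) true x + Literature.Analysis.FluidPDE.Torus.stokesMode (Pi.single (0 : Fin 3) (1 : ℤ)) (EuclideanSpace.single (2 : Fin 3) (1 : ℝ)) true x : EuclideanSpace ℝ (Fin 3))), (fun x : UnitAddTorus (Fin 3) => (Literature.Analysis.FluidPDE.Torus.stokesMode ![(0 : ℤ), 1, 1] (EuclideanSpace.single (0 : Fin 3) (1 : ℝ)) false x + Literature.Analysis.FluidPDE.Torus.stokesMode ![(1 : ℤ), 0, 1] (EuclideanSpace.single (1 : Fin 3) (1 : ℝ)) false x + Literature.Analysis.FluidPDE.Torus.stokesMode ![(1 : ℤ), 1, 0] (EuclideanSpace.single (2 : Fin 3) (1 : ℝ)) false x : EuclideanSpace ℝ (Fin 3)))]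

/-- The force `f_c = c₀ b₀ + c₁ b₁ + c₂ b₂` of the point `c ∈ ℝ³` (on the sphere `‖c‖ = 1`: the stirring sphere). -/
def force (c : EuclideanSpace ℝ (Fin 3)) : UnitAddTorus (Fin 3) → EuclideanSpace ℝ (Fin 3) :=
  fun x => ∑ i : Fin 3, c i • basis i x

/-- `BoundedAt E ν₀ c`: every `ν ∈ (0, ν₀)` admits a Foias–Prodi stationary statistical solution of NS_ν(f_c) with
integrable mean energy `≤ E` (the crux's matrix entry at direction `c`). -/
def BoundedAt (E ν₀ : ℝ) (c : EuclideanSpace ℝ (Fin 3)) : Prop :=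
  ∀ ν : ℝ, 0 < ν → ν < ν₀ →
    ∃ μ : Measure (Torus.energySpace (Fin 3)),
      FluidPDE.Torus.IsStationaryStatisticalSolution ν (force c) μ ∧
        Integrable (fun u : Torus.energySpace (Fin 3) => ‖u‖ ^ 2) μ ∧ FluidPDE.Torus.ensembleEnergy μ ≤ E

/-- **The crux by name ⟺ its `E, ν₀, c`-form.** -/
theorem crux_iff :
    BoundedSphereStatistics ↔
      ∃ E ν₀ : ℝ, 0 < E ∧ 0 < ν₀ ∧ ∀ c : EuclideanSpace ℝ (Fin 3), ‖c‖ = 1 → BoundedAt E ν₀ c := by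
  constructor
  · intro h
    exact h basis rfl
  · intro h b hb
    subst hb
    exact h

/-! ### Admissibility of every `f_c` (the tactic block of the route's `closes`, rev 4, verbatim) -/

/-- The route's support item `StirringSphere.SphereForcesAdmissible` (stmt-AnomalousDissipation-17149), proved as in
`Lines/birth.lean` / the route's `closes`: finite sums of scalar multiples of transversal Stokes modes are smooth,
solenoidal and mean-zero. [folklore] -/
theorem sphereForcesAdmissible : SphereForcesAdmissible := by
  have inner_latticeVec_single : ∀ (k : Fin 3 → ℤ) (i : Fin 3),
      inner ℝ (Literature.Analysis.FunctionSpaces.Torus.latticeVec k) (EuclideanSpace.single i (1 : ℝ)) = (k i : ℝ) := by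
    intro k i
    rw [EuclideanSpace.inner_single_right, Literature.Analysis.FunctionSpaces.Torus.latticeVec_apply]; simp
  have mode_admissible : ∀ (k : Fin 3 → ℤ) (i : Fin 3), k i = 0 → k ≠ 0 → ∀ cb : Bool,
      Literature.Analysis.FunctionSpaces.Torus.IsSmooth ⇑(Literature.Analysis.FluidPDE.Torus.stokesMode k (EuclideanSpace.single i (1 : ℝ)) cb) ∧
        Literature.Analysis.FunctionSpaces.Torus.IsDivFree ⇑(Literature.Analysis.FluidPDE.Torus.stokesMode k (EuclideanSpace.single i (1 : ℝ)) cb) ∧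
        Literature.Analysis.FunctionSpaces.Torus.HasZeroMean ⇑(Literature.Analysis.FluidPDE.Torus.stokesMode k (EuclideanSpace.single i (1 : ℝ)) cb) := by
    intro k i hki hk cb
    refine ⟨Literature.Analysis.FluidPDE.Torus.isSmooth_stokesMode _ _ _,
      Literature.Analysis.FluidPDE.Torus.isDivFree_stokesMode ?_ _,
      Literature.Analysis.FluidPDE.Torus.hasZeroMean_stokesMode hk _ _⟩
    rw [inner_latticeVec_single, hki]; simp
  have add3_admissible : ∀ {u v w : UnitAddTorus (Fin 3) → EuclideanSpace ℝ (Fin 3)},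
      (Literature.Analysis.FunctionSpaces.Torus.IsSmooth u ∧ Literature.Analysis.FunctionSpaces.Torus.IsDivFree u ∧ Literature.Analysis.FunctionSpaces.Torus.HasZeroMean u) →
      (Literature.Analysis.FunctionSpaces.Torus.IsSmooth v ∧ Literature.Analysis.FunctionSpaces.Torus.IsDivFree v ∧ Literature.Analysis.FunctionSpaces.Torus.HasZeroMean v) →
      (Literature.Analysis.FunctionSpaces.Torus.IsSmooth w ∧ Literature.Analysis.FunctionSpaces.Torus.IsDivFree w ∧ Literature.Analysis.FunctionSpaces.Torus.HasZeroMean w) →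
      Literature.Analysis.FunctionSpaces.Torus.IsSmooth (fun x => u x + v x + w x) ∧
        Literature.Analysis.FunctionSpaces.Torus.IsDivFree (fun x => u x + v x + w x) ∧
        Literature.Analysis.FunctionSpaces.Torus.HasZeroMean (fun x => u x + v x + w x) := by
    intro u v w hu hv hw
    have huv : Literature.Analysis.FunctionSpaces.Torus.IsSmooth (fun x => u x + v x) := hu.1.add hv.1
    exact ⟨huv.add hw.1,
      Summit.AnomalousDissipation.AnomalousDissipation.Theorems.SteadyStatesLoudBounded.GpAdmissible.isDivFree_add huv hw.1
        (Summit.AnomalousDissipation.AnomalousDissipation.Theorems.SteadyStatesLoudBounded.GpAdmissible.isDivFree_add hu.1 hv.1 hu.2.1 hv.2.1) hw.2.1,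
      Summit.AnomalousDissipation.AnomalousDissipation.Theorems.SteadyStatesLoudBounded.GpAdmissible.hasZeroMean_add huv hw.1
        (Summit.AnomalousDissipation.AnomalousDissipation.Theorems.SteadyStatesLoudBounded.GpAdmissible.hasZeroMean_add hu.1 hv.1 hu.2.2 hv.2.2) hw.2.2⟩
  have divergence_const_smul : ∀ {u : UnitAddTorus (Fin 3) → EuclideanSpace ℝ (Fin 3)}
      (hu : Literature.Analysis.FunctionSpaces.Torus.IsContDiff 1 u) (a : ℝ) (x : UnitAddTorus (Fin 3)),
      Literature.Analysis.FunctionSpaces.Torus.divergence (fun y => a • u y) x =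
        a * Literature.Analysis.FunctionSpaces.Torus.divergence u x := by
    intro u hu a x
    rw [show (fun y => a • u y) = a • u from rfl,
      Literature.Analysis.FunctionSpaces.Torus.divergence_eq_trace_fderiv (hu.smul a),
      Literature.Analysis.FunctionSpaces.Torus.divergence_eq_trace_fderiv hu,
      Literature.Analysis.FunctionSpaces.Torus.fderiv_const_smul hu a, ContinuousLinearMap.toLinearMap_smul,
      map_smul, smul_eq_mul]
  have smul_admissible : ∀ {u : UnitAddTorus (Fin 3) → EuclideanSpace ℝ (Fin 3)} (a : ℝ),
      (Literature.Analysis.FunctionSpaces.Torus.IsSmooth u ∧ Literature.Analysis.FunctionSpaces.Torus.IsDivFree u ∧ Literature.Analysis.FunctionSpaces.Torus.HasZeroMean u) →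
      Literature.Analysis.FunctionSpaces.Torus.IsSmooth (fun x => a • u x) ∧
        Literature.Analysis.FunctionSpaces.Torus.IsDivFree (fun x => a • u x) ∧
        Literature.Analysis.FunctionSpaces.Torus.HasZeroMean (fun x => a • u x) := by
    intro u a hu
    refine ⟨hu.1.smul a, fun x => ?_, ?_⟩
    · rw [divergence_const_smul (hu.1.isContDiff (by simp)) a x, hu.2.1 x, mul_zero]
    · have h0 : ∫ x, u x = 0 := hu.2.2
      show ∫ x, a • u x = 0
      rw [integral_smul, h0, smul_zero]
  have sum_admissible : ∀ (b : Fin 3 → UnitAddTorus (Fin 3) → EuclideanSpace ℝ (Fin 3)),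
      (∀ i, Literature.Analysis.FunctionSpaces.Torus.IsSmooth (b i) ∧ Literature.Analysis.FunctionSpaces.Torus.IsDivFree (b i) ∧ Literature.Analysis.FunctionSpaces.Torus.HasZeroMean (b i)) →
      ∀ c : EuclideanSpace ℝ (Fin 3),
      Literature.Analysis.FunctionSpaces.Torus.IsSmooth (fun x => ∑ i : Fin 3, c i • b i x) ∧
        Literature.Analysis.FunctionSpaces.Torus.IsDivFree (fun x => ∑ i : Fin 3, c i • b i x) ∧
        Literature.Analysis.FunctionSpaces.Torus.HasZeroMean (fun x => ∑ i : Fin 3, c i • b i x) := by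
    intro b hb c
    have h : (fun x => ∑ i : Fin 3, c i • b i x) = fun x => c 0 • b 0 x + c 1 • b 1 x + c 2 • b 2 x := by
      funext x; rw [Fin.sum_univ_three]
    rw [h]
    exact add3_admissible (smul_admissible (c 0) (hb 0)) (smul_admissible (c 1) (hb 1)) (smul_admissible (c 2) (hb 2))
  rintro b rfl c'
  refine sum_admissible _ ?_ c'
  have hne : ∀ j : Fin 3, (Pi.single j (1 : ℤ) : Fin 3 → ℤ) ≠ 0 := by
    intro j h; have := congr_fun h j; simp at this
  have hk2a : (![(0 : ℤ), 1, 1] : Fin 3 → ℤ) ≠ 0 := by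
    intro h; have := congr_fun h 1; simp at this
  have hk2b : (![(1 : ℤ), 0, 1] : Fin 3 → ℤ) ≠ 0 := by
    intro h; have := congr_fun h 0; simp at this
  have hk2c : (![(1 : ℤ), 1, 0] : Fin 3 → ℤ) ≠ 0 := by
    intro h; have := congr_fun h 0; simp at this
  intro i
  fin_cases i
  · exact add3_admissible
      (mode_admissible (Pi.single (2 : Fin 3) (1 : ℤ)) 0 (by simp) (hne 2) false)
      (mode_admissible (Pi.single (0 : Fin 3) (1 : ℤ)) 1 (by simp) (hne 0) false)
      (mode_admissible (Pi.single (1 : Fin 3) (1 : ℤ)) 2 (by simp) (hne 1) false)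
  · exact add3_admissible
      (mode_admissible (Pi.single (1 : Fin 3) (1 : ℤ)) 0 (by simp) (hne 1) true)
      (mode_admissible (Pi.single (2 : Fin 3) (1 : ℤ)) 1 (by simp) (hne 2) true)
      (mode_admissible (Pi.single (0 : Fin 3) (1 : ℤ)) 2 (by simp) (hne 0) true)
  · exact add3_admissible
      (mode_admissible ![(0 : ℤ), 1, 1] 0 (by simp) hk2a false)
      (mode_admissible ![(1 : ℤ), 0, 1] 1 (by simp) hk2b false)
      (mode_admissible ![(1 : ℤ), 1, 0] 2 (by simp) hk2c false)

/-- Every `f_c` is smooth, solenoidal and mean-zero. -/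
theorem force_admissible (c : EuclideanSpace ℝ (Fin 3)) :
    Torus.IsSmooth (force c) ∧ Torus.IsDivFree (force c) ∧ Torus.HasZeroMean (force c) :=
  sphereForcesAdmissible basis rfl c

/-- `f_c ∈ L²`. -/
theorem force_memLp (c : EuclideanSpace ℝ (Fin 3)) : MemLp (force c) 2 volume :=
  (force_admissible c).1.memLp 2

/-! ### Pointwise size of the forces: `‖f_c(x)‖ ≤ 9` on the closed unit ball of `c` -/

/-- A Stokes mode with a unit coordinate amplitude has pointwise norm `≤ 1` (`|cos|, |sin| ≤ 1`). [folklore] -/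
theorem norm_stokesMode_single_le (k : Fin 3 → ℤ) (j : Fin 3) (cb : Bool) (x : UnitAddTorus (Fin 3)) :
    ‖Literature.Analysis.FluidPDE.Torus.stokesMode k (EuclideanSpace.single j (1 : ℝ)) cb x‖ ≤ 1 := by
  rw [Literature.Analysis.FluidPDE.Torus.stokesMode_apply, norm_smul, PiLp.norm_single, norm_one, mul_one]
  have h1 : ‖mFourier k x‖ = 1 := by simp [mFourier]
  split_ifs
  · rw [Real.norm_eq_abs]; exact (Complex.abs_re_le_norm _).trans h1.le
  · rw [Real.norm_eq_abs]; exact (Complex.abs_im_le_norm _).trans h1.le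

/-- Each basis field has pointwise norm `≤ 3`. [folklore] -/
theorem norm_basis_le (i : Fin 3) (x : UnitAddTorus (Fin 3)) : ‖basis i x‖ ≤ 3 := by
  have key : ∀ (k₁ k₂ k₃ : Fin 3 → ℤ) (j₁ j₂ j₃ : Fin 3) (cb : Bool),
      ‖(Literature.Analysis.FluidPDE.Torus.stokesMode k₁ (EuclideanSpace.single j₁ (1 : ℝ)) cb x +
          Literature.Analysis.FluidPDE.Torus.stokesMode k₂ (EuclideanSpace.single j₂ (1 : ℝ)) cb x +
          Literature.Analysis.FluidPDE.Torus.stokesMode k₃ (EuclideanSpace.single j₃ (1 : ℝ)) cb x : EuclideanSpace ℝ (Fin 3))‖ ≤ 3 := by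
    intro k₁ k₂ k₃ j₁ j₂ j₃ cb
    have h₁ := norm_stokesMode_single_le k₁ j₁ cb x
    have h₂ := norm_stokesMode_single_le k₂ j₂ cb x
    have h₃ := norm_stokesMode_single_le k₃ j₃ cb x
    have := norm_add₃_le (a := Literature.Analysis.FluidPDE.Torus.stokesMode k₁ (EuclideanSpace.single j₁ (1 : ℝ)) cb x)
      (b := Literature.Analysis.FluidPDE.Torus.stokesMode k₂ (EuclideanSpace.single j₂ (1 : ℝ)) cb x)
      (c := Literature.Analysis.FluidPDE.Torus.stokesMode k₃ (EuclideanSpace.single j₃ (1 : ℝ)) cb x)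
    linarith
  fin_cases i
  · exact key _ _ _ 0 1 2 false
  · exact key _ _ _ 0 1 2 true
  · exact key _ _ _ 0 1 2 false

/-- `‖f_c(x)‖ ≤ 9` whenever `‖c‖ ≤ 1` (so `∫ ‖f_c‖² ≤ 81`; the exact value on the sphere is `3/2`, not needed). [folklore] -/
theorem norm_force_le {c : EuclideanSpace ℝ (Fin 3)} (hc : ‖c‖ ≤ 1) (x : UnitAddTorus (Fin 3)) :
    ‖force c x‖ ≤ 9 := by
  unfold force
  calc ‖∑ i : Fin 3, c i • basis i x‖ ≤ ∑ i : Fin 3, ‖c i • basis i x‖ := norm_sum_le _ _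
    _ ≤ ∑ _i : Fin 3, (1 : ℝ) * 3 := by
        refine Finset.sum_le_sum fun i _ => ?_
        rw [norm_smul]
        exact mul_le_mul ((PiLp.norm_apply_le c i).trans hc) (norm_basis_le i x) (norm_nonneg _) zero_le_one
    _ = 9 := by simp; norm_num

/-- `‖f_c‖_{L²} ≤ 9` whenever `‖c‖ ≤ 1`. [folklore] -/
theorem norm_toLp_force_le {c : EuclideanSpace ℝ (Fin 3)} (hc : ‖c‖ ≤ 1) :
    ‖(force_memLp c).toLp (force c)‖ ≤ 9 := by
  rw [Lp.norm_toLp]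
  refine ENNReal.toReal_le_of_le_ofReal (by norm_num) ?_
  refine (eLpNorm_le_of_ae_bound (C := 9) (ae_of_all _ fun x => norm_force_le hc x)).trans ?_
  simp

/-- `∫ ‖f_c‖² ≤ 81` whenever `‖c‖ ≤ 1`. [folklore] -/
theorem integral_norm_sq_force_le {c : EuclideanSpace ℝ (Fin 3)} (hc : ‖c‖ ≤ 1) :
    ∫ x, ‖force c x‖ ^ 2 ≤ 81 := by
  have h : ∀ x, ‖force c x‖ ^ 2 ≤ (81 : ℝ) := fun x => by
    have := norm_force_le hc x
    have h0 := norm_nonneg (force c x)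
    nlinarith
  calc ∫ x, ‖force c x‖ ^ 2 ≤ ∫ _x : UnitAddTorus (Fin 3), (81 : ℝ) :=
        integral_mono_of_nonneg (ae_of_all _ fun x => by positivity) (integrable_const _) (ae_of_all _ h)
    _ = 81 := by simp


/-! ## §1 What is in tree at FIXED viscosity — the content of the crux is ν-uniformity only -/

/-- **Per-viscosity bounded statistics on the whole closed ball of forces** (PROVED, in-tree ingredients only): for every
`ν > 0` and every `c` with `‖c‖ ≤ 1`, the Dirac mass at Temam's steady weak solution `u ∈ V` of NS_ν(f_c)
(`Temam1979_exists_steadyWeakSolution_holds`) is a Foias–Prodi stationary statistical solution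
(`isStationaryStatisticalSolution_dirac_holds`, FMRT IV §1.2) with integrable mean energy `‖u‖² ≤ 81/(16π⁴ν²)`
(support bound `IsStationaryStatisticalSolution.ae_norm_le`, FMRT IV (1.34), and `‖f_c‖_{L²} ≤ 9`). [folklore] -/
theorem perViscosity {ν : ℝ} (hν : 0 < ν) {c : EuclideanSpace ℝ (Fin 3)} (hc : ‖c‖ ≤ 1) :
    ∃ μ : Measure (Torus.energySpace (Fin 3)),
      FluidPDE.Torus.IsStationaryStatisticalSolution ν (force c) μ ∧
        Integrable (fun u : Torus.energySpace (Fin 3) => ‖u‖ ^ 2) μ ∧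
        FluidPDE.Torus.ensembleEnergy μ ≤ 81 / (16 * Real.pi ^ 4 * ν ^ 2) := by
  have hf : MemLp (force c) 2 volume := force_memLp c
  obtain ⟨u, hV, hu⟩ := FluidPDE.Torus.Temam1979_exists_steadyWeakSolution_holds (d := Fin 3) (by simp) hν hf
  have hstat : FluidPDE.Torus.IsStationaryStatisticalSolution ν (force c) (Measure.dirac u) :=
    FluidPDE.Torus.isStationaryStatisticalSolution_dirac_holds hν.le hf (by simp) hV hu
  refine ⟨Measure.dirac u, hstat, FluidPDE.Torus.integrable_dirac u _, ?_⟩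
  have hae := hstat.ae_norm_le hν hf
  have hmeas : MeasurableSet
      {v : Torus.energySpace (Fin 3) | ‖v‖ ≤ ‖hf.toLp (force c)‖ / (4 * Real.pi ^ 2 * ν)} :=
    measurableSet_le continuous_norm.measurable measurable_const
  have hu_le : ‖u‖ ≤ ‖hf.toLp (force c)‖ / (4 * Real.pi ^ 2 * ν) := (ae_dirac_iff hmeas).1 hae
  have h9 : ‖hf.toLp (force c)‖ ≤ 9 := norm_toLp_force_le hc
  have hpos : 0 < 4 * Real.pi ^ 2 * ν := by positivity
  have hR : ‖u‖ ≤ 9 / (4 * Real.pi ^ 2 * ν) := hu_le.trans (div_le_div_of_nonneg_right h9 hpos.le)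
  have hE : FluidPDE.Torus.ensembleEnergy (Measure.dirac u) = ‖u‖ ^ 2 := by
    unfold FluidPDE.Torus.ensembleEnergy
    exact integral_dirac' _ _ ((continuous_norm.pow 2).stronglyMeasurable)
  rw [hE]
  calc ‖u‖ ^ 2 ≤ (9 / (4 * Real.pi ^ 2 * ν)) ^ 2 := pow_le_pow_left₀ (norm_nonneg _) hR 2
    _ = 81 / (16 * Real.pi ^ 4 * ν ^ 2) := by
        field_simp
        ring

/-- **The crux WITHOUT ν-uniformity is a theorem**: with `∃ E` moved inside `∀ ν` (one level per viscosity, still uniform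
over the whole sphere), `BoundedSphereStatistics` holds with `E(ν) = 81/(16π⁴ν²)`. So the ENTIRE content of the crux is the
ν-uniformity of one number (census §0). [folklore] -/
theorem crux_withoutUniformity (ν : ℝ) (hν : 0 < ν) :
    ∃ E : ℝ, 0 < E ∧ ∀ c : EuclideanSpace ℝ (Fin 3), ‖c‖ = 1 →
      ∃ μ : Measure (Torus.energySpace (Fin 3)),
        FluidPDE.Torus.IsStationaryStatisticalSolution ν (force c) μ ∧
          Integrable (fun u : Torus.energySpace (Fin 3) => ‖u‖ ^ 2) μ ∧ FluidPDE.Torus.ensembleEnergy μ ≤ E :=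
  ⟨81 / (16 * Real.pi ^ 4 * ν ^ 2), by positivity, fun _c hc => perViscosity hν hc.le⟩

/-! ## §S STRENGTHEN -/

/-- **S⁺_rel — relative floor on the sphere**: for some `ν₀ > 0`, every unit `c` and every `ν ∈ (0, ν₀)` admit a
stationary statistical solution of NS_ν(f_c) whose mean dissipation pays a fixed fraction of its mean energy,
`c₀ · ∫|u|²dμ ≤ ν ∫‖∇u‖²dμ` (Taylor microscale `≲ √ν`, the K41 expectation). The only multiplicative strengthening the
ensemble energy inequality can convert into an energy bound (census §S2); with an energy FLOOR (Liouville identity tested on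
`f_c`) it is a DISSIPATION floor at every direction, i.e. the route's target species — summit-strength. -/
def RelativeFloorSphere (c₀ : ℝ) : Prop :=
  ∃ ν₀ : ℝ, 0 < ν₀ ∧ ∀ c : EuclideanSpace ℝ (Fin 3), ‖c‖ = 1 → ∀ ν : ℝ, 0 < ν → ν < ν₀ →
    ∃ μ : Measure (Torus.energySpace (Fin 3)),
      FluidPDE.Torus.IsStationaryStatisticalSolution ν (force c) μ ∧
        Integrable (fun u : Torus.energySpace (Fin 3) => ‖u‖ ^ 2) μ ∧
        c₀ * FluidPDE.Torus.ensembleEnergy μ ≤ FluidPDE.Torus.ensembleDissipation ν μ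

/-- The algebra of S⁺_rel: `c₀ E ≤ ε ≤ ‖f_c‖√E ≤ 9√E` forces `E ≤ 81/c₀²` (in-tree power budget
`ensembleDissipation_le_of_isStationary_holds`, FMRT IV (1.31)–(1.33) / Doering–Foias 2002 §2). [folklore] -/
theorem ensembleEnergy_le_of_relativeFloor {c₀ ν : ℝ} (hc₀ : 0 < c₀) {c : EuclideanSpace ℝ (Fin 3)} (hc : ‖c‖ ≤ 1)
    {μ : Measure (Torus.energySpace (Fin 3))} (hμ : FluidPDE.Torus.IsStationaryStatisticalSolution ν (force c) μ)
    (hint : Integrable (fun u : Torus.energySpace (Fin 3) => ‖u‖ ^ 2) μ)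
    (hrel : c₀ * FluidPDE.Torus.ensembleEnergy μ ≤ FluidPDE.Torus.ensembleDissipation ν μ) :
    FluidPDE.Torus.ensembleEnergy μ ≤ 81 / c₀ ^ 2 := by
  have hbudget := FluidPDE.Torus.ensembleDissipation_le_of_isStationary_holds hμ (force_memLp c) hint
  have hsqrt : Real.sqrt (∫ x, ‖force c x‖ ^ 2) ≤ 9 := by
    rw [show (9 : ℝ) = Real.sqrt (9 ^ 2) by rw [Real.sqrt_sq (by norm_num)]]
    exact Real.sqrt_le_sqrt (by linarith [integral_norm_sq_force_le hc])
  set E := FluidPDE.Torus.ensembleEnergy μ with hEdef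
  have hE0 : 0 ≤ E := integral_nonneg fun _ => by positivity
  have h1 : c₀ * E ≤ 9 * Real.sqrt E :=
    hrel.trans (hbudget.trans (mul_le_mul_of_nonneg_right hsqrt (Real.sqrt_nonneg _)))
  have hs : Real.sqrt E ^ 2 = E := Real.sq_sqrt hE0
  have hs0 : 0 ≤ Real.sqrt E := Real.sqrt_nonneg _
  have h2 : Real.sqrt E ≤ 9 / c₀ := by
    rw [le_div_iff₀ hc₀]
    by_cases hz : Real.sqrt E = 0
    · rw [hz]; simp
    · have hspos : 0 < Real.sqrt E := lt_of_le_of_ne hs0 (Ne.symm hz)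
      have h3 : c₀ * Real.sqrt E * Real.sqrt E ≤ 9 * Real.sqrt E := by nlinarith
      have h4 : c₀ * Real.sqrt E ≤ 9 := le_of_mul_le_mul_right h3 hspos
      linarith
  calc E = Real.sqrt E ^ 2 := hs.symm
    _ ≤ (9 / c₀) ^ 2 := pow_le_pow_left₀ hs0 h2 2
    _ = 81 / c₀ ^ 2 := by rw [div_pow]; norm_num

/-- **S⁺_rel → the crux** with `E = 81/c₀²` (PROVED). -/
theorem crux_of_relativeFloorSphere {c₀ : ℝ} (hc₀ : 0 < c₀) (h : RelativeFloorSphere c₀) :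
    BoundedSphereStatistics := by
  rw [crux_iff]
  obtain ⟨ν₀, hν₀, H⟩ := h
  refine ⟨81 / c₀ ^ 2, ν₀, by positivity, hν₀, fun c hc ν hν hνlt => ?_⟩
  obtain ⟨μ, hstat, hint, hrel⟩ := H c hc ν hν hνlt
  exact ⟨μ, hstat, hint, ensembleEnergy_le_of_relativeFloor hc₀ hc.le hstat hint hrel⟩

/-- **S⁺_abs — universal ceiling on the sphere**: SOME level bounds the mean energy of EVERY integrable stationary
statistical solution of every `f_c`, `ν < ν₀`. The ∀-species of the negatives index (2979 / 2984 / 0204) read on `H`;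
it implies the crux through the fixed-ν existence theorem (`crux_of_universalCeiling`) and is REFUTED on this sphere by the
exact hot Beltrami states of the two ABC directions (`not_universalCeiling_of_hotBeltramiDirac`). -/
def UniversalCeilingSphere : Prop :=
  ∃ E ν₀ : ℝ, 0 < E ∧ 0 < ν₀ ∧ ∀ c : EuclideanSpace ℝ (Fin 3), ‖c‖ = 1 → ∀ ν : ℝ, 0 < ν → ν < ν₀ →
    ∀ μ : Measure (Torus.energySpace (Fin 3)),
      FluidPDE.Torus.IsStationaryStatisticalSolution ν (force c) μ →
        Integrable (fun u : Torus.energySpace (Fin 3) => ‖u‖ ^ 2) μ → FluidPDE.Torus.ensembleEnergy μ ≤ E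

/-- S⁺_abs → the crux (PROVED: the Dirac witness of `perViscosity` exists and the ceiling bounds it). -/
theorem crux_of_universalCeiling (h : UniversalCeilingSphere) : BoundedSphereStatistics := by
  rw [crux_iff]
  obtain ⟨E, ν₀, hE, hν₀, H⟩ := h
  refine ⟨E, ν₀, hE, hν₀, fun c hc ν hν hνlt => ?_⟩
  obtain ⟨μ, hstat, hint, -⟩ := perViscosity hν hc.le
  exact ⟨μ, hstat, hint, H c hc ν hν hνlt μ hstat hint⟩

/-- The ABC direction `c₊ = (e₀ + e₁)/√2` of the sphere: `f_{c₊} = (b₀ + b₁)/√2` is a Beltrami field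
(`curl f = 2π f`, the `1:1:1` ABC flow), so `u = f_{c₊}/(4π²ν)` is an EXACT steady state of NS_ν(f_{c₊}) for every `ν`
(`B(u,u) = ∇|u|²/2`), of energy `(3/2)/(16π⁴ν²)` (refuter stamp 2026-08-16; DNS self-test of kit j024177: residual 5·10⁻¹⁵). -/
def abcPlus : EuclideanSpace ℝ (Fin 3) :=
  (Real.sqrt 2)⁻¹ • (EuclideanSpace.single (0 : Fin 3) (1 : ℝ) + EuclideanSpace.single (1 : Fin 3) (1 : ℝ))

theorem norm_abcPlus : ‖abcPlus‖ = 1 := by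
  unfold abcPlus
  have h2 : ‖(EuclideanSpace.single (0 : Fin 3) (1 : ℝ) + EuclideanSpace.single (1 : Fin 3) (1 : ℝ))‖ = Real.sqrt 2 := by
    rw [EuclideanSpace.norm_eq]
    congr 1
    simp [Fin.sum_univ_three]
    norm_num
  rw [norm_smul, norm_inv, Real.norm_eq_abs, abs_of_pos (Real.sqrt_pos.2 two_pos), h2,
    inv_mul_cancel₀ (Real.sqrt_ne_zero'.2 two_pos)]

/-- **The hot Beltrami Dirac** (classical; TYPED, not proved here — the inertial-term identity `b(u,u,w) = 0` for this
trigonometric Beltrami field against every test field is not in the tree): for every `ν > 0` the Dirac mass at the exact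
laminar state `f_{c₊}/(4π²ν)` is a stationary statistical solution of NS_ν(f_{c₊}) with integrable mean energy
`= (3/2)/(16π⁴ν²)` (FMRT 2001 Ch. IV §1.2, remark after Def. 1.3; Beltrami cancellation `u × curl u = 0`). -/
def HotBeltramiDirac : Prop :=
  ∀ ν : ℝ, 0 < ν → ∃ μ : Measure (Torus.energySpace (Fin 3)),
    FluidPDE.Torus.IsStationaryStatisticalSolution ν (force abcPlus) μ ∧
      Integrable (fun u : Torus.energySpace (Fin 3) => ‖u‖ ^ 2) μ ∧
      FluidPDE.Torus.ensembleEnergy μ = 3 / 2 / (16 * Real.pi ^ 4 * ν ^ 2)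

/-- **The universal ceiling dies on the sphere** (PROVED from `HotBeltramiDirac`): the laminar Diracs of the ABC direction
have mean energy `(3/2)/(16π⁴ν²) → ∞`. This is why the crux is — and must stay — EXISTENTIAL over statistics. -/
theorem not_universalCeiling_of_hotBeltramiDirac (h : HotBeltramiDirac) : ¬ UniversalCeilingSphere := by
  rintro ⟨E, ν₀, hE, hν₀, H⟩
  set a : ℝ := 3 / 2 / (16 * Real.pi ^ 4 * E) with ha
  have ha0 : 0 < a := by positivity
  set ν : ℝ := min (ν₀ / 2) (min (a / 2) (1 / 2)) with hνdef
  have hν0 : 0 < ν := by positivity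
  have hν₀' : ν < ν₀ := (min_le_left _ _).trans_lt (half_lt_self hν₀)
  have hνa : ν < a := ((min_le_right _ _).trans (min_le_left _ _)).trans_lt (half_lt_self ha0)
  have hν1 : ν < 1 := ((min_le_right _ _).trans (min_le_right _ _)).trans_lt (by norm_num)
  have hνsq : ν ^ 2 < a := by nlinarith
  obtain ⟨μ, hstat, hint, hEμ⟩ := h ν hν0
  have hle := H abcPlus norm_abcPlus ν hν0 hν₀' μ hstat hint
  rw [hEμ] at hle
  have hpi : 0 < 16 * Real.pi ^ 4 := by positivity
  rw [ha, lt_div_iff₀ (by positivity)] at hνsq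
  rw [div_le_iff₀ (by positivity)] at hle
  nlinarith

/-! ## §D DECOMPOSITION -/

/-- **Local-in-`c` uniform bounds** (Sub of the localisation split): every point of the sphere has a neighbourhood on
which ONE level `E` and ONE threshold `ν₀` work. Equivalent to the crux by compactness (`crux_of_locallyBounded`, and
trivially conversely) — it isolates what the sphere adds to the per-force problem: NOTHING but local uniformity in `c`. -/
def LocallyBounded : Prop :=
  ∀ c : EuclideanSpace ℝ (Fin 3), ‖c‖ = 1 → ∃ δ E ν₀ : ℝ, 0 < δ ∧ 0 < E ∧ 0 < ν₀ ∧
    ∀ c' : EuclideanSpace ℝ (Fin 3), ‖c'‖ = 1 → dist c' c < δ → BoundedAt E ν₀ c'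

/-- **Uniformisation over the compact sphere** (PROVED): `LocallyBounded → BoundedSphereStatistics` by a finite subcover
of `S²` (sum of the levels, min of the thresholds). The seam of every sphere-wise split is this soft topology. [folklore] -/
theorem crux_of_locallyBounded (h : LocallyBounded) : BoundedSphereStatistics := by
  rw [crux_iff]
  classical
  choose! δ E ν₀ hδ hE hν₀ hB using h
  have hcomp : IsCompact (Metric.sphere (0 : EuclideanSpace ℝ (Fin 3)) 1) := isCompact_sphere 0 1
  obtain ⟨t, hts, hcover⟩ := hcomp.elim_nhds_subcover (fun c => Metric.ball c (δ c))
    (fun c hc => Metric.ball_mem_nhds c (hδ c (by simpa using hc)))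
  have hne : t.Nonempty := by
    have hmem : EuclideanSpace.single (0 : Fin 3) (1 : ℝ) ∈ Metric.sphere (0 : EuclideanSpace ℝ (Fin 3)) 1 := by
      simp
    obtain ⟨c, hc, -⟩ := Set.mem_iUnion₂.1 (hcover hmem)
    exact ⟨c, hc⟩
  refine ⟨∑ c ∈ t, E c, t.inf' hne ν₀, ?_, ?_, ?_⟩
  · exact Finset.sum_pos (fun c hc => hE c (by simpa using hts c hc)) hne
  · obtain ⟨c, hc, h'⟩ := Finset.exists_mem_eq_inf' hne ν₀
    rw [h']
    exact hν₀ c (by simpa using hts c hc)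
  · intro c' hc' ν hν hνlt
    have hmem : c' ∈ Metric.sphere (0 : EuclideanSpace ℝ (Fin 3)) 1 := by simpa using hc'
    obtain ⟨c, hc, hball⟩ := Set.mem_iUnion₂.1 (hcover hmem)
    have hcs : ‖c‖ = 1 := by simpa using hts c hc
    have hlt : ν < ν₀ c := lt_of_lt_of_le hνlt (Finset.inf'_le _ hc)
    obtain ⟨μ, hstat, hint, hEμ⟩ := hB c hcs c' hc' (Metric.mem_ball.1 hball) ν hν hlt
    refine ⟨μ, hstat, hint, hEμ.trans ?_⟩
    exact Finset.single_le_sum (fun d hd => (hE d (by simpa using hts d hd)).le) hc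

/-- **Pointwise energy half on the sphere** (Sub₁ of the pointwise ∧ robust split): force by force, the energy half of the
zeroth law in ensemble form — the per-force KERNEL (the sibling crux `GPMeanBoundedFamily`'s ensemble Sub₁ at `c = e₀`,
strengthened from a sequence to all small ν). -/
def Pointwise : Prop :=
  ∀ c : EuclideanSpace ℝ (Fin 3), ‖c‖ = 1 → ∃ E ν₀ : ℝ, 0 < E ∧ 0 < ν₀ ∧ BoundedAt E ν₀ c

/-- **ν-uniform force-robustness of bounded statistics** (Sub₂): a bounded-statistics certificate at `c` propagates to a
neighbourhood of `c` NOT shrinking with ν (level doubled). Cheskidov's force-robust species (inviscid statistics need not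
be continuous in the force; `Literature.Barriers.AnomalousDissipation.ForceRobustNoAnomalyNarrow` is the catalogued
neighbour) — open, and not obviously easier than Sub₁. -/
def Robust : Prop :=
  ∀ (c : EuclideanSpace ℝ (Fin 3)) (E ν₀ : ℝ), ‖c‖ = 1 → 0 < E → 0 < ν₀ → BoundedAt E ν₀ c →
    ∃ δ : ℝ, 0 < δ ∧ ∀ c' : EuclideanSpace ℝ (Fin 3), ‖c'‖ = 1 → dist c' c < δ → BoundedAt (2 * E) ν₀ c'

/-- Sub₁ ∧ Sub₂ → local uniformity (PROVED, two lines). -/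
theorem locallyBounded_of_pointwise_robust (h₁ : Pointwise) (h₂ : Robust) : LocallyBounded := by
  intro c hc
  obtain ⟨E, ν₀, hE, hν₀, hB⟩ := h₁ c hc
  obtain ⟨δ, hδ, H⟩ := h₂ c E ν₀ hc hE hν₀ hB
  exact ⟨δ, 2 * E, ν₀, hδ, by positivity, hν₀, H⟩

/-- **The pointwise ∧ robust split closes the crux** (PROVED glue: `Pointwise → Robust → BoundedSphereStatistics`).
Not filed with `route edit --split`: Sub₁ is the per-force open problem verbatim and Sub₂ is open of the force-robust
species (census §D2). -/
theorem crux_of_pointwise_robust (h₁ : Pointwise) (h₂ : Robust) : BoundedSphereStatistics :=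
  crux_of_locallyBounded (locallyBounded_of_pointwise_robust h₁ h₂)

/-- Conversely the crux gives Sub₁ (and `LocallyBounded`) for free — Sub₁ is a genuine WEAKENING. -/
theorem pointwise_of_crux (h : BoundedSphereStatistics) : Pointwise := by
  rw [crux_iff] at h
  obtain ⟨E, ν₀, hE, hν₀, H⟩ := h
  exact fun c hc => ⟨E, ν₀, hE, hν₀, H c hc⟩

/-! ## §N NEGATION -/

/-- **The shape of any disproof** (PROVED): `¬ crux` iff for EVERY level `E` and threshold `ν₀` SOME unit direction and
SOME `ν ∈ (0, ν₀)` make EVERY integrable stationary statistical solution there carry mean energy `> E` — a UNIVERSAL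
lower bound over the whole Foias–Prodi class at one `(c, ν)`, to be produced for unboundedly large `E`. -/
theorem not_crux_iff :
    ¬ BoundedSphereStatistics ↔
      ∀ E ν₀ : ℝ, 0 < E → 0 < ν₀ → ∃ c : EuclideanSpace ℝ (Fin 3), ‖c‖ = 1 ∧ ∃ ν : ℝ, 0 < ν ∧ ν < ν₀ ∧
        ∀ μ : Measure (Torus.energySpace (Fin 3)),
          FluidPDE.Torus.IsStationaryStatisticalSolution ν (force c) μ →
            Integrable (fun u : Torus.energySpace (Fin 3) => ‖u‖ ^ 2) μ → E < FluidPDE.Torus.ensembleEnergy μ := by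
  rw [crux_iff]
  unfold BoundedAt
  push Not
  rfl

/-- **A hoarding direction**: ONE unit `c` at which, for every level, all integrable stationary statistical solutions of
NS_ν(f_c) exceed the level once ν is small (e.g. a direction whose every statistics follows the Stokes scaling `≍ ν⁻²`,
as first-shell forces do in TWO dimensions — `TwodBoundedEnergyZeroMomentum/Negative/FirstShellGeneral`). -/
def HoardingDirection : Prop :=
  ∃ c : EuclideanSpace ℝ (Fin 3), ‖c‖ = 1 ∧ ∀ E : ℝ, ∃ ν₁ : ℝ, 0 < ν₁ ∧ ∀ ν : ℝ, 0 < ν → ν < ν₁ →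
    ∀ μ : Measure (Torus.energySpace (Fin 3)),
      FluidPDE.Torus.IsStationaryStatisticalSolution ν (force c) μ →
        Integrable (fun u : Torus.energySpace (Fin 3) => ‖u‖ ^ 2) μ → E < FluidPDE.Torus.ensembleEnergy μ

/-- **One hoarding direction kills the crux** (PROVED) — the minimal shape of a refutation `refuted:BoundedSphereStatistics`
(route header KILL CRITERIA). No engine produces it in 3-D (census §N): the only rigorous hoarding theorem (2-D first shell,
Marchioro / Constantin–Foias–Temam) rests on `(B(u,u), Au) = 0`, false in 3-D; the laminar ABC states are linearly
unstable for `R ≳ 13` (Galloway–Frisch 1987); and the DNS sphere census (kit j024187) looks for a direction with `ν²E ↛ 0`. -/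
theorem not_crux_of_hoardingDirection (h : HoardingDirection) : ¬ BoundedSphereStatistics := by
  rw [not_crux_iff]
  intro E ν₀ _hE hν₀
  obtain ⟨c, hc, H⟩ := h
  obtain ⟨ν₁, hν₁, H1⟩ := H E
  refine ⟨c, hc, min ν₀ ν₁ / 2, by positivity, ?_, fun μ hμ hint => H1 _ (by positivity) ?_ μ hμ hint⟩
  · exact (half_lt_self (by positivity)).trans_le (min_le_left _ _)
  · exact (half_lt_self (by positivity)).trans_le (min_le_right _ _)

end Summit.AnomalousDissipation.AnomalousDissipation.Cruxes.BoundedSphereStatistics.StrategyCensus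

end
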